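import Summits.ResolutionOfSingularities.ResolutionOfSingularities.Theorems.PurelyInseparableDim4LoopCLocalEscape
import Summits.ResolutionOfSingularities.ResolutionOfSingularities.Theorems.PurelyInseparableDim4FlatAbsorbPrep
import Summits.ResolutionOfSingularities.ResolutionOfSingularities.Theorems.PurelyInseparableDim4Equimultiple
import HarnessLib
import HarnessLib.Audit.Tags

/-!
# Purely inseparable fourfolds — BOUNDED WINS («A wins within `n` moves») for the coordinate-centre game
# [OURS · counted 0 · game bookkeeping for OUR frame, not about resolution]

Census cell «res-dim4-pi» (D-0157 DOOR 2), width seat `res-dim4-p-6` (g6), part 1 of the VALUE-CERTIFICATE format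
(`PurelyInseparableDim4ValueCert`), taking `res-dim4-idea-2` g11's offer (bus 2026-08-29 14:03:44Z): idea-2's located
objects of the «RES-only (2,2) game» carry a game VALUE `ρ` (length of optimal play: A forces the origin to stop being
`q`-fold within `ρ` moves against every `𝔽₂`-rational answer, and B keeps it `q`-fold for `ρ − 1` rounds against every
permissible coordinate centre).  The `ℕ`-bounded layer of p-14's attractor machinery (`PurelyInseparableDim4GameDeterminacy`):

* §1 `Game.WinsIn legal succ n x` — «A wins within `n` of its own moves»: `WinsIn.wins`, `WinsIn.mono`,
  `winsIn_zero_iff`, `winsIn_succ_iff`, `not_winsIn_zero` / `not_winsIn_succ` (B's side), `winsIn_antitone_succ`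
  (shrinking B's answers keeps bounded wins), and the links to the ordinal rank `WinsIn.rankLE : WinsIn n → RankLE n`,
  `winsIn_succ_of_rankLE : RankLE n → WinsIn (n + 1)` (the rank does not charge for a move without answers; the move
  count does — so `rank ≤ value ≤ rank + 1` on the attractor).
* §2 `ValueCert.ResWinsIn q β n s` — the state game with legality `IsPermissibleCentre q S s.F` ONLY (no scope
  conjunct: idea-2's RES-only game — out-of-scope states are played on; a state is terminal, i.e. won, iff its origin is
  not `q`-fold) and B's answers in a reply class `β` (p-6 g2's `LoopCLocal.RSucc`): `β ≡ true` = TRAVEL = the tree's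
  `Edge` (`resWinsIn_top_stateWins : ResWinsIn q ⊤ n s → StateWins q s`, p-14's full game), `LoopCLocal.localB` =
  NO-TRAVEL (B answers over the current point), `origB` = ORIGINS-ONLY (chart origins, the polyhedra game with cleaning);
  `resWinsIn_mono_class`, **`resWinsIn_congr`** (the bounded attractor reads `F` only), and the reading of
  «equimultiple point» as «the child's origin is `q`-fold» (`isEquimultiplePoint_iff_isPermissibleCentre_univ_step`,
  from typ-3's `Equimultiple.isEquimultiplePoint_iff_le_ordZero_step`).

CAVEAT: statements about OUR frame's game; `K`-rational answers; nothing here proves F4-C in any form or resolution of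
singularities in dimension ≥ 4 / characteristic `p`; counted 0; AI kernel work, weaker than expert review.
bears_on: LADDER-RESOLUTION:D157-DOOR2 (res-dim4-pi · value-certificate format, part 1). Supports
stmt-ResolutionOfSingularities-16155 (helper).
-/

set_option linter.dupNamespace false

noncomputable section

namespace Summit.ResolutionOfSingularities.ResolutionOfSingularities.Theorems.PIDim4
/-! ## 1. Abstract reachability games: A wins within `n` moves -/

namespace Game

variable {P M : Type}

section Defn

variable (legal : P → M → Prop) (succ : P → M → P → Prop)

/-- **Bounded attractor**: `WinsIn n x` — player A wins from `x` within `n` of its own moves: a position without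
legal move is won at once (any budget); a legal move all of whose answers are won within `n` wins within `n + 1`.
[folklore] -/
inductive WinsIn : ℕ → P → Prop
  | terminal {n : ℕ} {x : P} (h : ∀ m, ¬ legal x m) : WinsIn n x
  | move {n : ℕ} {x : P} {m : M} (hm : legal x m) (h : ∀ y, succ x m y → WinsIn n y) : WinsIn (n + 1) x

end Defn

variable {legal : P → M → Prop} {succ : P → M → P → Prop}

/-- A bounded win is a win. [folklore] -/
theorem WinsIn.wins {n : ℕ} {x : P} (h : WinsIn legal succ n x) : Wins legal succ x := by
  induction h with
  | terminal h => exact Wins.terminal h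
  | move hm _ ih => exact Wins.move hm ih

/-- Budgets are upward closed. [folklore] -/
theorem WinsIn.mono {n : ℕ} {x : P} (h : WinsIn legal succ n x) {m : ℕ} (hnm : n ≤ m) :
    WinsIn legal succ m x := by
  induction h generalizing m with
  | terminal h => exact WinsIn.terminal h
  | @move k x mv hm _ ih =>
    obtain ⟨m', rfl⟩ : ∃ m', m = m' + 1 := ⟨m - 1, by omega⟩
    exact WinsIn.move hm fun y hy => ih y hy (by omega)

/-- Budget `0`: won iff no legal move. [folklore] -/
theorem winsIn_zero_iff {x : P} : WinsIn legal succ 0 x ↔ ∀ m, ¬ legal x m := by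
  constructor
  · intro h
    cases h with
    | terminal h => exact h
  · exact fun h => WinsIn.terminal h

/-- Budget `n + 1`: won iff no legal move, or some legal move all of whose answers are won within `n`. [folklore] -/
theorem winsIn_succ_iff {n : ℕ} {x : P} :
    WinsIn legal succ (n + 1) x ↔
      (∀ m, ¬ legal x m) ∨ ∃ m, legal x m ∧ ∀ y, succ x m y → WinsIn legal succ n y := by
  constructor
  · intro h
    cases h with
    | terminal h => exact Or.inl h
    | move hm h => exact Or.inr ⟨_, hm, h⟩
  · rintro (h | ⟨m, hm, h⟩)
    · exact WinsIn.terminal h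
    · exact WinsIn.move hm h

/-- **B's side, budget `0`**: a position with a legal move is not won within `0` moves. [folklore] -/
theorem not_winsIn_zero {x : P} (hleg : ∃ m, legal x m) : ¬ WinsIn legal succ 0 x := fun hw => by
  obtain ⟨m, hm⟩ := hleg
  exact (winsIn_zero_iff.mp hw) m hm

/-- **B's side, budget `n + 1`**: if a legal move exists and EVERY legal move has an answer not won within `n`,
the position is not won within `n + 1`. [folklore] -/
theorem not_winsIn_succ {n : ℕ} {x : P} (hleg : ∃ m, legal x m)
    (h : ∀ m, legal x m → ∃ y, succ x m y ∧ ¬ WinsIn legal succ n y) : ¬ WinsIn legal succ (n + 1) x := by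
  intro hw
  rcases winsIn_succ_iff.mp hw with h0 | ⟨m, hm, hall⟩
  · obtain ⟨m, hm⟩ := hleg
    exact h0 m hm
  · obtain ⟨y, hy, hny⟩ := h m hm
    exact hny (hall y hy)

/-- Shrinking B's answers keeps every bounded win. [folklore] -/
theorem winsIn_antitone_succ {succ' : P → M → P → Prop} (hs : ∀ x m y, succ' x m y → succ x m y) {n : ℕ} {x : P}
    (h : WinsIn legal succ n x) : WinsIn legal succ' n x := by
  induction h with
  | terminal h => exact WinsIn.terminal h
  | @move k x m hm _ ih => exact WinsIn.move (m := m) hm fun y hy => ih y (hs x m y hy)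

/-- **Link to the ordinal rank**: a win within `n` moves is a rank bound `n`. [folklore] -/
theorem WinsIn.rankLE {n : ℕ} {x : P} (h : WinsIn legal succ n x) : RankLE legal succ (n : Ordinal.{0}) x := by
  induction h with
  | terminal h => exact RankLE.terminal h
  | @move k x m hm _ ih =>
    refine RankLE.move (fun _ => (k : Ordinal.{0})) hm (fun y _ => ?_) fun y hy => ih y hy
    exact_mod_cast Nat.lt_succ_self k

/-- **Converse link**: a rank bound `n` is a win within `n + 1` moves (the rank does not charge for a move without
answers, the move count does). Hence `rank ≤ value ≤ rank + 1` on the attractor. [folklore] -/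
theorem winsIn_succ_of_rankLE : ∀ (n : ℕ) {x : P}, RankLE legal succ (n : Ordinal.{0}) x → WinsIn legal succ (n + 1) x := by
  intro n
  induction n with
  | zero =>
    intro x h
    generalize hα : ((0 : ℕ) : Ordinal.{0}) = α at h
    cases h with
    | terminal h => exact WinsIn.terminal h
    | move ρ hm hlt h =>
      refine WinsIn.move hm fun y hy => ?_
      have hy' := hlt y hy
      rw [← hα, Nat.cast_zero] at hy'
      exact absurd hy' (by simp)
  | succ k ih =>
    intro x h
    generalize hα : ((k + 1 : ℕ) : Ordinal.{0}) = α at h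
    cases h with
    | terminal h => exact WinsIn.terminal h
    | move ρ hm hlt h =>
      refine WinsIn.move hm fun y hy => ih ?_
      have hy' := hlt y hy
      rw [← hα, Nat.cast_succ] at hy'
      exact RankLE.mono legal succ (h y hy) (Order.lt_add_one_iff.mp hy')

end Game

/-! ## 2. The RES-only state game with a reply class -/

namespace ValueCert

open MvPolynomial Finset
open Literature.AlgebraicGeometry.Resolution
open Literature.AlgebraicGeometry.Resolution.CentreBlowup
open StepKit WinCertSound InScopeWinCert LoopCLocal

variable {K : Type} [Field K] [DecidableEq K]

/-- **`ResWinsIn q β n s`**: in the coordinate-centre game at the exponent `q` with B's answers restricted to the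
class `β` (`LoopCLocal.RSucc`), player A — moving a permissible coordinate centre whenever one exists, at in-scope
and out-of-scope states alike — forces a state whose origin is no longer `q`-fold within `n` moves. [folklore] -/
def ResWinsIn (q : ℕ) (β : Finset (Fin 4) → Fin 4 → (Fin 4 → K) → Bool) (n : ℕ) (s : State K) : Prop :=
  Game.WinsIn (fun (t : State K) (S : Finset (Fin 4)) => IsPermissibleCentre q S t.F) (RSucc q β) n s

/-- **The ORIGINS-ONLY reply class**: B answers with a chart origin (`b = 0`; the spine / polyhedra game with
cleaning). [folklore] -/
def origB (_S : Finset (Fin 4)) (_j : Fin 4) (b : Fin 4 → K) : Bool :=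
  decide (∀ i : Fin 4, b i = 0)

/-- A TRAVEL-game bounded win (`β ≡ true`: every `K`-rational `b` with `b_j = 0`) is a win of the full game of
record (`StateWins`, p-14). [folklore] -/
theorem resWinsIn_top_stateWins {q n : ℕ} {s : State K} (h : ResWinsIn q (fun _ _ _ => true) n s) :
    StateWins q s := by
  have hw := Game.WinsIn.wins h
  exact wins_antitone_succ (fun x m y hy => (rSucc_top_iff q x m y).mpr hy) hw

/-- Shrinking B's reply class keeps every bounded win. [folklore] -/
theorem resWinsIn_mono_class {q n : ℕ} {β β' : Finset (Fin 4) → Fin 4 → (Fin 4 → K) → Bool}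
    (hβ : ∀ S j b, β' S j b = true → β S j b = true) {s : State K} (h : ResWinsIn q β n s) :
    ResWinsIn q β' n s := by
  refine Game.winsIn_antitone_succ (fun x m y hy => ?_) h
  obtain ⟨j, b, hj, hb, hβ', heq, hne, hy'⟩ := hy
  exact ⟨j, b, hj, hb, hβ m j b hβ', heq, hne, hy'⟩

/-- A `β`-answer out of `s` has a twin out of any state with the same `F`, with the same child `F`. [folklore] -/
theorem rSucc_congr {q : ℕ} {β : Finset (Fin 4) → Fin 4 → (Fin 4 → K) → Bool} {S : Finset (Fin 4)}
    {s t s' : State K} (h : s.F = t.F) (he : RSucc q β s S s') : ∃ t', RSucc q β t S t' ∧ s'.F = t'.F := by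
  obtain ⟨j, b, hj, hbj, hβ, heq, hne, rfl⟩ := he
  refine ⟨step q S j b t, ⟨j, b, hj, hbj, hβ, (FlatAbsorb.isEquimultiplePoint_congr q S j b h).mp heq, ?_, rfl⟩,
    FlatAbsorb.step_F_congr q S j b h⟩
  rwa [← FlatAbsorb.step_F_congr q S j b h]

/-- **The bounded attractor reads `F` only.** [folklore] -/
theorem resWinsIn_congr {q n : ℕ} {β : Finset (Fin 4) → Fin 4 → (Fin 4 → K) → Bool} {s : State K}
    (hs : ResWinsIn q β n s) : ∀ t : State K, t.F = s.F → ResWinsIn q β n t := by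
  unfold ResWinsIn at hs ⊢
  induction hs with
  | terminal hno =>
    intro t ht
    exact Game.WinsIn.terminal fun S hS => hno S (by rw [← ht]; exact hS)
  | @move k x S hm _ ih =>
    intro t ht
    refine Game.WinsIn.move (m := S) (by rw [ht]; exact hm) fun t' ht' => ?_
    obtain ⟨x', hx', hF⟩ := rSucc_congr ht ht'
    exact ih x' hx' t' hF

omit [DecidableEq K] in
/-- A permissible centre exists iff the point is a permissible centre (the origin is `q`-fold). [folklore] -/
theorem exists_isPermissibleCentre_iff_univ {q : ℕ} (F : MvPolynomial (Fin 4) K) :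
    (∃ S, IsPermissibleCentre q S F) ↔ IsPermissibleCentre q Finset.univ F := by
  rw [exists_isPermissibleCentre_iff]
  exact ⟨fun h => ⟨Finset.univ_nonempty, h⟩, fun h => h.2⟩

/-- **Equimultiple point ⟺ the child's origin is `q`-fold** (`Equimultiple.isEquimultiplePoint_iff_le_ordZero_step`
read through `IsPermissibleCentre univ`). [folklore] -/
theorem isEquimultiplePoint_iff_isPermissibleCentre_univ_step (q : ℕ) (S : Finset (Fin 4)) (j : Fin 4)
    (b : Fin 4 → K) (s : State K) :
    IsEquimultiplePoint q S j b s ↔ IsPermissibleCentre q Finset.univ (step q S j b s).F := by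
  rw [Equimultiple.isEquimultiplePoint_iff_le_ordZero_step, IsPermissibleCentre, CentreBlowup.ordAlong_univ]
  exact ⟨fun h => ⟨Finset.univ_nonempty, h⟩, fun h => h.2⟩

end ValueCert

end Summit.ResolutionOfSingularities.ResolutionOfSingularities.Theorems.PIDim4

end
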